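import Mathlib
import Summits.AtomisticToContinuum.Crystallization.Theses.PhononSlackCertificates
import Summits.AtomisticToContinuum.Crystallization.Theorems.PhononSlackCertificatesNearFarGlueRFill
import Summits.AtomisticToContinuum.Crystallization.Theorems.PhononSlackCertificatesNearFarGlueRWellBonded
import Summits.AtomisticToContinuum.Crystallization.Theorems.PhononSlackCertificatesNearFarGlueRLooseReduction
import Summits.AtomisticToContinuum.Crystallization.Theorems.PhononSlackCertificatesNearFarGlueRLooseTarget
import Literature.MathematicalPhysics.StatisticalMechanics.LennardJonesClusters

/-!
# Crux `PhononSlackCertificates.NearFarGlueR` (stmt-AtomisticToContinuum-14970), line `Sketch`: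
CORE exhaustion — every configuration reduces to a well-bonded, hole-free core

Continuation lead c4, part 3b (toward the registered sub-goal `stub_coreReduction`).  Two monotone
operations on a finite configuration each LOWER the excess `𝓔(x) − N·e*` by a fixed quantum while
changing the counts `#T` (tight contacts) and `#bad` by a bounded amount:

* STRIP the loose particles (`A_j ≥ −θ`, `θ < 0.711`): excess drops by `≥ 0.711 − θ` per particle
  (`strip_round_loose`, certified `e* ≤ −0.711`), `#T` by `≤ 5833`, `#bad` by `≤ 1332` per
  particle (`card_contact_le_strip`, `card_bad_le_strip`);
* FILL a deep hole (`W_p ≤ −98309653/125000000 − g`, `p` at distance `≥ 3/10` from everything):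
  excess drops by `≥ g` (`fill_energy`, certified two-cone floor `e* ≥ −0.7865`), `#T` by
  `≤ 5833`, `#bad` by `≤ 1332` (`card_contact_le_fill`, `card_bad_le_fill`).

Since the excess is `≥ 0` (periodisation), at most `excess / min(0.711 − θ, g)` operations are
possible, so alternating them terminates (`exists_core_of_sep`, strong induction on the energy
budget `M`, `excess ≤ c·M`) in a **core**: `3/10`-separated, `θ`-WELL-BONDED (`A_j < −θ` for
every particle — bound at least like a kink atom of a near-optimal crystal when `θ ≈ 0.71`) and
`g`-HOLE-FREE (no vacant site binds a test particle by more than `0.7865 + g`: no vacancy, no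
divacancy, no small vacancy cluster, anywhere).  `exists_core` runs c3's net-bound exhaustion
first (to get separation) and then the alternation: every finite injective `x` has a core `z` with
`[𝓔(z) − K·e*] + min(0.711 − θ, g)·u ≤ 𝓔(x) − N·e*`, `#T(x) ≤ #T(z) + 5833·u`,
`#bad(x) ≤ #bad(z) + 1332·u`.  All `[folklore]`.
-/

noncomputable section

namespace Summit.AtomisticToContinuum.Crystallization.Theorems.PhononSlackCertificatesNearFarGlueR

open Literature.MathematicalPhysics.StatisticalMechanics
open Literature.Geometry.DiscreteGeometry
open Summit.AtomisticToContinuum.Crystallization.Theses.PhononSlackCertificates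
open Summit.AtomisticToContinuum.Crystallization.Theorems.ChargedEnergyGapNegative
  (eStar card_mul_eStar_le)
open scoped BigOperators

/-! ## §1 Core exhaustion on separated configurations (induction on the energy budget) -/

/-- **Core exhaustion.**  Fix `θ < 0.711` and `g > 0`, `c := min(0.711 − θ, g)`.  Every
`3/10`-separated configuration `x` whose excess `𝓔(x) − N·e*` is at most `c·M` reaches, by at
most `M` strips of loose particles (`A_j ≥ −θ`) and fills of deep holes (`W_p ≤
−98309653/125000000 − g`, `p` at distance `≥ 3/10` from everything), a CORE `z`: `3/10`-separated,
`θ`-well-bonded and `g`-hole-free, with `[𝓔(z) − K·e*] + c·u ≤ 𝓔(x) − N·e*`,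
`#T(x) ≤ #T(z) + 5833·u` and `#bad(x) ≤ #bad(z) + 1332·u` (`u` = number of operations). [folklore] -/
theorem exists_core_of_sep {θ g : ℝ} (hθ : θ < 711 / 1000) (hg : 0 < g) :
    ∀ (M N : ℕ) (x : Fin N → EuclideanSpace ℝ (Fin 3)),
      (∀ i j : Fin N, i ≠ j → (3 / 10 : ℝ) ≤ dist (x i) (x j)) →
      interactionEnergy lennardJones x -
          (N : ℝ) * (⨅ Q : PeriodicConfiguration 3, Q.energyPerParticle lennardJones) ≤
        min (711 / 1000 - θ) g * M →
      ∃ (K : ℕ) (z : Fin K → EuclideanSpace ℝ (Fin 3)) (u : ℕ),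
        (∀ i j : Fin K, i ≠ j → (3 / 10 : ℝ) ≤ dist (z i) (z j)) ∧
        (∀ j : Fin K, ∑ k ∈ Finset.univ.erase j,
          (min (lennardJones (dist (z j) (z k))) 0 +
            (1 / 2 : ℝ) * max (lennardJones (dist (z j) (z k))) 0) < -θ) ∧
        (∀ p : EuclideanSpace ℝ (Fin 3), (∀ i : Fin K, (3 / 10 : ℝ) ≤ dist p (z i)) →
          -(98309653 / 125000000 : ℝ) - g < ∑ i, lennardJones (dist p (z i))) ∧
        interactionEnergy lennardJones z -
            (K : ℝ) * (⨅ Q : PeriodicConfiguration 3, Q.energyPerParticle lennardJones) +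
            min (711 / 1000 - θ) g * u ≤
          interactionEnergy lennardJones x -
            (N : ℝ) * (⨅ Q : PeriodicConfiguration 3, Q.energyPerParticle lennardJones) ∧
        (Nat.card {j : Fin N // ¬ IsTwoShellGood (1 / 20) (47 / 50) 1 x j ∧
            ∃ i : Fin N, IsTwoShellGood (1 / 20) (47 / 50) 1 x i ∧ dist (x i) (x j) ≤ 21 / 20} : ℝ) ≤
          (Nat.card {j : Fin K // ¬ IsTwoShellGood (1 / 20) (47 / 50) 1 z j ∧
            ∃ i : Fin K, IsTwoShellGood (1 / 20) (47 / 50) 1 z i ∧ dist (z i) (z j) ≤ 21 / 20} : ℝ) +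
            5833 * u ∧
        (Nat.card {j : Fin N // ¬ IsTwoShellGood (1 / 20) (47 / 50) 1 x j} : ℝ) ≤
          (Nat.card {j : Fin K // ¬ IsTwoShellGood (1 / 20) (47 / 50) 1 z j} : ℝ) + 1332 * u := by
  classical
  set c : ℝ := min (711 / 1000 - θ) g with hc
  have hc0 : 0 < c := lt_min (by linarith) hg
  have hcθ : c ≤ 711 / 1000 - θ := min_le_left _ _
  have hcg : c ≤ g := min_le_right _ _
  intro M
  induction M using Nat.strong_induction_on with
  | _ M ih =>
    intro N x hsep hE
    have hx : Function.Injective x := fibre_injective_of_separated (by norm_num) hsep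
    by_cases hwb : ∀ j : Fin N, ∑ k ∈ Finset.univ.erase j,
        (min (lennardJones (dist (x j) (x k))) 0 +
          (1 / 2 : ℝ) * max (lennardJones (dist (x j) (x k))) 0) < -θ
    · by_cases hhf : ∀ p : EuclideanSpace ℝ (Fin 3), (∀ i : Fin N, (3 / 10 : ℝ) ≤ dist p (x i)) →
          -(98309653 / 125000000 : ℝ) - g < ∑ i, lennardJones (dist p (x i))
      · -- `x` is already a core
        exact ⟨N, x, 0, hsep, hwb, hhf, by simp, by simp, by simp⟩
      · -- FILL a deep hole and recurse
        push Not at hhf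
        obtain ⟨p, hp, hWp⟩ := hhf
        set y := Fin.append x (fun _ : Fin 1 => p) with hy
        have hysep := fill_sep x hsep p hp
        have hyinj : Function.Injective y := fibre_injective_of_separated (by norm_num) hysep
        have hEy := fill_energy x p hWp
        have hy0 : ((N + 1 : ℕ) : ℝ) * (⨅ Q : PeriodicConfiguration 3,
            Q.energyPerParticle lennardJones) ≤ interactionEnergy lennardJones y :=
          card_mul_eStar_le hyinj
        push_cast at hy0
        -- the budget is at least one quantum, so `M ≥ 1`
        have hM1 : 1 ≤ M := by
          by_contra hM
          push Not at hM
          have hM0 : M = 0 := by omega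
          rw [hM0] at hE
          simp only [Nat.cast_zero, mul_zero] at hE
          linarith
        have hcast : ((M - 1 : ℕ) : ℝ) = (M : ℝ) - 1 := by
          rw [Nat.cast_sub hM1, Nat.cast_one]
        have hEy' : interactionEnergy lennardJones y -
            ((N + 1 : ℕ) : ℝ) * (⨅ Q : PeriodicConfiguration 3, Q.energyPerParticle lennardJones) ≤
            c * ((M - 1 : ℕ) : ℝ) := by
          rw [hcast]
          push_cast
          nlinarith [hEy, hE, hcg]
        obtain ⟨K, z, u, hzsep, hzwb, hzhf, hEz, hTz, hBz⟩ :=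
          ih (M - 1) (by omega) (N + 1) y hysep hEy'
        refine ⟨K, z, u + 1, hzsep, hzwb, hzhf, ?_, ?_, ?_⟩
        · push_cast at hEz ⊢
          nlinarith [hEz, hEy, hcg]
        · have hT := card_contact_le_fill x hsep p
          push_cast
          linarith [hT, hTz]
        · have hB := card_bad_le_fill x hsep p
          push_cast
          linarith [hB, hBz]
    · -- STRIP the loose particles and recurse
      set W := Finset.univ.filter fun j : Fin N => -θ ≤ ∑ k ∈ Finset.univ.erase j,
        (min (lennardJones (dist (x j) (x k))) 0 +
          (1 / 2 : ℝ) * max (lennardJones (dist (x j) (x k))) 0) with hW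
      have hWne : W.Nonempty := by
        push Not at hwb
        obtain ⟨j, hj⟩ := hwb
        exact ⟨j, Finset.mem_filter.2 ⟨Finset.mem_univ _, hj⟩⟩
      have hWpos : (1 : ℝ) ≤ W.card := by exact_mod_cast Finset.card_pos.2 hWne
      set f₀ := (Wᶜ).orderEmbOfFin rfl with hf₀
      have hmap : Finset.univ.map f₀.toEmbedding = Wᶜ := Finset.map_orderEmbOfFin_univ Wᶜ rfl
      set y := x ∘ f₀.toEmbedding with hy
      have hysep : ∀ k l : Fin (Wᶜ.card), k ≠ l → (3 / 10 : ℝ) ≤ dist (y k) (y l) :=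
        fun k l hkl => hsep _ _ fun h => hkl (f₀.toEmbedding.injective h)
      have hround := strip_round_loose x W f₀.toEmbedding hmap θ
        (fun j hj => (Finset.mem_filter.1 hj).2)
      have hK : ((Wᶜ.card : ℕ) : ℝ) = (N : ℝ) - (W.card : ℝ) := by
        rw [Finset.card_compl, Fintype.card_fin, Nat.cast_sub (by simpa using W.card_le_univ)]
      have hy0 : ((Wᶜ.card : ℕ) : ℝ) * (⨅ Q : PeriodicConfiguration 3,
          Q.energyPerParticle lennardJones) ≤ interactionEnergy lennardJones y :=
        card_mul_eStar_le (hx.comp f₀.toEmbedding.injective)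
      have hquant : c ≤ (711 / 1000 - θ) * (W.card : ℝ) := by nlinarith [hcθ, hWpos, hc0]
      have hM1 : 1 ≤ M := by
        by_contra hM
        push Not at hM
        have hM0 : M = 0 := by omega
        rw [hM0] at hE
        simp only [Nat.cast_zero, mul_zero] at hE
        have hyE : interactionEnergy lennardJones y -
            ((Wᶜ.card : ℕ) : ℝ) * (⨅ Q : PeriodicConfiguration 3,
              Q.energyPerParticle lennardJones) + (711 / 1000 - θ) * (W.card : ℝ) ≤
            interactionEnergy lennardJones x -
              (N : ℝ) * (⨅ Q : PeriodicConfiguration 3, Q.energyPerParticle lennardJones) := hround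
        linarith
      have hcast : ((M - 1 : ℕ) : ℝ) = (M : ℝ) - 1 := by
        rw [Nat.cast_sub hM1, Nat.cast_one]
      have hEy' : interactionEnergy lennardJones y -
          ((Wᶜ.card : ℕ) : ℝ) * (⨅ Q : PeriodicConfiguration 3, Q.energyPerParticle lennardJones) ≤
          c * ((M - 1 : ℕ) : ℝ) := by
        rw [hcast]
        have hyE : interactionEnergy lennardJones y -
            ((Wᶜ.card : ℕ) : ℝ) * (⨅ Q : PeriodicConfiguration 3,
              Q.energyPerParticle lennardJones) + (711 / 1000 - θ) * (W.card : ℝ) ≤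
            interactionEnergy lennardJones x -
              (N : ℝ) * (⨅ Q : PeriodicConfiguration 3, Q.energyPerParticle lennardJones) := hround
        nlinarith [hyE, hE, hquant]
      obtain ⟨K, z, u, hzsep, hzwb, hzhf, hEz, hTz, hBz⟩ :=
        ih (M - 1) (by omega) (Wᶜ.card) y hysep hEy'
      refine ⟨K, z, u + W.card, hzsep, hzwb, hzhf, ?_, ?_, ?_⟩
      · have hyE : interactionEnergy lennardJones y -
            ((Wᶜ.card : ℕ) : ℝ) * (⨅ Q : PeriodicConfiguration 3,
              Q.energyPerParticle lennardJones) + (711 / 1000 - θ) * (W.card : ℝ) ≤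
            interactionEnergy lennardJones x -
              (N : ℝ) * (⨅ Q : PeriodicConfiguration 3, Q.energyPerParticle lennardJones) := hround
        have hcW : c * (W.card : ℝ) ≤ (711 / 1000 - θ) * (W.card : ℝ) :=
          mul_le_mul_of_nonneg_right hcθ (by linarith)
        push_cast
        nlinarith [hEz, hyE, hcW]
      · have hT := card_contact_le_strip x f₀.toEmbedding hysep
        rw [hK] at hT
        have hT' : (Nat.card {j : Fin N // ¬ IsTwoShellGood (1 / 20) (47 / 50) 1 x j ∧
            ∃ i : Fin N, IsTwoShellGood (1 / 20) (47 / 50) 1 x i ∧ dist (x i) (x j) ≤ 21 / 20} : ℝ) ≤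
            5833 * (W.card : ℝ) +
            (Nat.card {k : Fin (Wᶜ.card) // ¬ IsTwoShellGood (1 / 20) (47 / 50) 1 y k ∧
              ∃ i : Fin (Wᶜ.card), IsTwoShellGood (1 / 20) (47 / 50) 1 y i ∧
                dist (y i) (y k) ≤ 21 / 20} : ℝ) := by
          have := hT; simp only [hy] at this ⊢; linarith
        push_cast
        linarith [hT', hTz]
      · have hB := card_bad_le_strip x f₀.toEmbedding hysep
        rw [hK] at hB
        have hB' : (Nat.card {j : Fin N // ¬ IsTwoShellGood (1 / 20) (47 / 50) 1 x j} : ℝ) ≤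
            1332 * (W.card : ℝ) +
            (Nat.card {k : Fin (Wᶜ.card) // ¬ IsTwoShellGood (1 / 20) (47 / 50) 1 y k} : ℝ) := by
          have := hB; simp only [hy] at this ⊢; linarith
        push_cast
        linarith [hB', hBz]

/-! ## §2 Every configuration has a core -/

/-- **Every finite injective configuration has a core.**  For `0 ≤ θ < 0.711` and `g > 0`: strip to
the net-bound core first (c3's `exists_netBound_core`, which makes the configuration
`3/10`-separated at `0.711` per stripped particle), then alternate strips and fills
(`exists_core_of_sep`); the result is `3/10`-separated, `θ`-well-bonded and `g`-hole-free, with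
`[𝓔(z) − K·e*] + min(0.711 − θ, g)·u ≤ 𝓔(x) − N·e*`, `#T(x) ≤ #T(z) + 5833·u`,
`#bad(x) ≤ #bad(z) + 1332·u`. [folklore] -/
theorem exists_core {θ g : ℝ} (hθ0 : 0 ≤ θ) (hθ : θ < 711 / 1000) (hg : 0 < g)
    {N : ℕ} (x : Fin N → EuclideanSpace ℝ (Fin 3)) (hx : Function.Injective x) :
    ∃ (K : ℕ) (z : Fin K → EuclideanSpace ℝ (Fin 3)) (u : ℕ),
      (∀ i j : Fin K, i ≠ j → (3 / 10 : ℝ) ≤ dist (z i) (z j)) ∧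
      (∀ j : Fin K, ∑ k ∈ Finset.univ.erase j,
        (min (lennardJones (dist (z j) (z k))) 0 +
          (1 / 2 : ℝ) * max (lennardJones (dist (z j) (z k))) 0) < -θ) ∧
      (∀ p : EuclideanSpace ℝ (Fin 3), (∀ i : Fin K, (3 / 10 : ℝ) ≤ dist p (z i)) →
        -(98309653 / 125000000 : ℝ) - g < ∑ i, lennardJones (dist p (z i))) ∧
      interactionEnergy lennardJones z -
          (K : ℝ) * (⨅ Q : PeriodicConfiguration 3, Q.energyPerParticle lennardJones) +
          min (711 / 1000 - θ) g * u ≤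
        interactionEnergy lennardJones x -
          (N : ℝ) * (⨅ Q : PeriodicConfiguration 3, Q.energyPerParticle lennardJones) ∧
      (Nat.card {j : Fin N // ¬ IsTwoShellGood (1 / 20) (47 / 50) 1 x j ∧
          ∃ i : Fin N, IsTwoShellGood (1 / 20) (47 / 50) 1 x i ∧ dist (x i) (x j) ≤ 21 / 20} : ℝ) ≤
        (Nat.card {j : Fin K // ¬ IsTwoShellGood (1 / 20) (47 / 50) 1 z j ∧
          ∃ i : Fin K, IsTwoShellGood (1 / 20) (47 / 50) 1 z i ∧ dist (z i) (z j) ≤ 21 / 20} : ℝ) +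
          5833 * u ∧
      (Nat.card {j : Fin N // ¬ IsTwoShellGood (1 / 20) (47 / 50) 1 x j} : ℝ) ≤
        (Nat.card {j : Fin K // ¬ IsTwoShellGood (1 / 20) (47 / 50) 1 z j} : ℝ) + 1332 * u := by
  classical
  set c : ℝ := min (711 / 1000 - θ) g with hc
  have hc0 : 0 < c := lt_min (by linarith) hg
  have hc1 : c ≤ 711 / 1000 := (min_le_left _ _).trans (by linarith)
  -- phase 1: strip to the net-bound core (this gives `3/10`-separation)
  obtain ⟨K₁, f₁, hnet, hE₁⟩ := exists_netBound_core N x hx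
  set y := x ∘ f₁ with hy
  have hyinj : Function.Injective y := hx.comp f₁.injective
  have hysep : ∀ k l : Fin K₁, k ≠ l → (3 / 10 : ℝ) ≤ dist (y k) (y l) := sep_of_netBound y hyinj hnet
  have hT₁ := card_contact_le_strip x f₁ hysep
  have hB₁ := card_bad_le_strip x f₁ hysep
  have hKN : K₁ ≤ N := by simpa using Fintype.card_le_of_embedding f₁
  have hKNr : (0 : ℝ) ≤ (N : ℝ) - K₁ := by
    have : (K₁ : ℝ) ≤ N := by exact_mod_cast hKN
    linarith
  -- phase 2: alternate strips and fills within the energy budget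
  have hy0 : (K₁ : ℝ) * (⨅ Q : PeriodicConfiguration 3, Q.energyPerParticle lennardJones) ≤
      interactionEnergy lennardJones y := card_mul_eStar_le hyinj
  set exc : ℝ := interactionEnergy lennardJones y -
      (K₁ : ℝ) * (⨅ Q : PeriodicConfiguration 3, Q.energyPerParticle lennardJones) with hexc
  set M : ℕ := ⌈exc / c⌉₊ with hM
  have hbudget : exc ≤ c * M := by
    have h1 : exc / c ≤ M := Nat.le_ceil _
    rw [div_le_iff₀ hc0] at h1
    linarith
  obtain ⟨K, z, u, hzsep, hzwb, hzhf, hEz, hTz, hBz⟩ := exists_core_of_sep hθ hg M K₁ y hysep hbudget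
  refine ⟨K, z, u + (N - K₁), hzsep, hzwb, hzhf, ?_, ?_, ?_⟩
  · have hcast : ((u + (N - K₁) : ℕ) : ℝ) = (u : ℝ) + ((N : ℝ) - K₁) := by
      push_cast [Nat.cast_sub hKN]; ring
    rw [hcast]
    have hcNK : c * ((N : ℝ) - K₁) ≤ (711 / 1000 : ℝ) * ((N : ℝ) - K₁) :=
      mul_le_mul_of_nonneg_right hc1 hKNr
    have hEz' : interactionEnergy lennardJones z -
        (K : ℝ) * (⨅ Q : PeriodicConfiguration 3, Q.energyPerParticle lennardJones) + c * u ≤ exc := hEz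
    nlinarith [hEz', hE₁, hcNK]
  · have hcast : ((u + (N - K₁) : ℕ) : ℝ) = (u : ℝ) + ((N : ℝ) - K₁) := by
      push_cast [Nat.cast_sub hKN]; ring
    rw [hcast]
    have hT₁' : (Nat.card {j : Fin N // ¬ IsTwoShellGood (1 / 20) (47 / 50) 1 x j ∧
        ∃ i : Fin N, IsTwoShellGood (1 / 20) (47 / 50) 1 x i ∧ dist (x i) (x j) ≤ 21 / 20} : ℝ) ≤
        5833 * ((N : ℝ) - K₁) +
        (Nat.card {k : Fin K₁ // ¬ IsTwoShellGood (1 / 20) (47 / 50) 1 y k ∧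
          ∃ i : Fin K₁, IsTwoShellGood (1 / 20) (47 / 50) 1 y i ∧ dist (y i) (y k) ≤ 21 / 20} : ℝ) := by
      have := hT₁; simp only [hy] at this ⊢; linarith
    linarith [hT₁', hTz]
  · have hcast : ((u + (N - K₁) : ℕ) : ℝ) = (u : ℝ) + ((N : ℝ) - K₁) := by
      push_cast [Nat.cast_sub hKN]; ring
    rw [hcast]
    have hB₁' : (Nat.card {j : Fin N // ¬ IsTwoShellGood (1 / 20) (47 / 50) 1 x j} : ℝ) ≤
        1332 * ((N : ℝ) - K₁) +
        (Nat.card {k : Fin K₁ // ¬ IsTwoShellGood (1 / 20) (47 / 50) 1 y k} : ℝ) := by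
      have := hB₁; simp only [hy] at this ⊢; linarith
    linarith [hB₁', hBz]


/-- **Registered sub-goal `stub_coreExhaustion` of the crux item** (skeleton `Lines/Sketch.lean`,
c4): every finite injective configuration has a well-bonded, hole-free, `3/10`-separated core —
the statement of `exists_core` in closed form. [folklore] -/
theorem stub_coreExhaustion :
    ∀ (θ g : ℝ), 0 ≤ θ → θ < 711 / 1000 → 0 < g →
    ∀ (N : ℕ) (x : Fin N → EuclideanSpace ℝ (Fin 3)), Function.Injective x →
    ∃ (K : ℕ) (z : Fin K → EuclideanSpace ℝ (Fin 3)) (u : ℕ),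
      (∀ i j : Fin K, i ≠ j → (3 / 10 : ℝ) ≤ dist (z i) (z j)) ∧
      (∀ j : Fin K, ∑ k ∈ Finset.univ.erase j,
        (min (lennardJones (dist (z j) (z k))) 0 +
          (1 / 2 : ℝ) * max (lennardJones (dist (z j) (z k))) 0) < -θ) ∧
      (∀ p : EuclideanSpace ℝ (Fin 3), (∀ i : Fin K, (3 / 10 : ℝ) ≤ dist p (z i)) →
        -(98309653 / 125000000 : ℝ) - g < ∑ i, lennardJones (dist p (z i))) ∧
      interactionEnergy lennardJones z -
          (K : ℝ) * (⨅ Q : PeriodicConfiguration 3, Q.energyPerParticle lennardJones) +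
          min (711 / 1000 - θ) g * u ≤
        interactionEnergy lennardJones x -
          (N : ℝ) * (⨅ Q : PeriodicConfiguration 3, Q.energyPerParticle lennardJones) ∧
      (Nat.card {j : Fin N // ¬ IsTwoShellGood (1 / 20) (47 / 50) 1 x j ∧
          ∃ i : Fin N, IsTwoShellGood (1 / 20) (47 / 50) 1 x i ∧ dist (x i) (x j) ≤ 21 / 20} : ℝ) ≤
        (Nat.card {j : Fin K // ¬ IsTwoShellGood (1 / 20) (47 / 50) 1 z j ∧
          ∃ i : Fin K, IsTwoShellGood (1 / 20) (47 / 50) 1 z i ∧ dist (z i) (z j) ≤ 21 / 20} : ℝ) +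
          5833 * u ∧
      (Nat.card {j : Fin N // ¬ IsTwoShellGood (1 / 20) (47 / 50) 1 x j} : ℝ) ≤
        (Nat.card {j : Fin K // ¬ IsTwoShellGood (1 / 20) (47 / 50) 1 z j} : ℝ) + 1332 * u :=
  fun _ _ hθ0 hθ hg _ x hx => exists_core hθ0 hθ hg x hx

end Summit.AtomisticToContinuum.Crystallization.Theorems.PhononSlackCertificatesNearFarGlueR

end
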